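import Literature.MathematicalPhysics.QuantumFieldTheory.TorusChart
import Mathlib.Tactic.Abel
import HarnessLib

/-!
# Axial sums along one direction of a charted torus

Single-direction calculus on a charted torus `F : TorusChart Λ d` (`TorusChart.lean`), the tool for sweeping
out one coordinate at a time (used by the degree-`2` Poincaré lemma `TorusChartCurlPrimitive.lean`):

* `TorusChart.dropCoord F k x` — the foot of `x` on the slice `{x_k = 0}` (all other coordinates kept);
  its coordinates, and how it moves under unit steps (`dropCoord_add_gen_self`: invariant under `e_k`;
  `dropCoord_add_gen_of_ne`: equivariant under `e_i`, `i ≠ k`; `add_gen_eq_dropCoord`: the wrapping `k`-step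
  lands on the foot);
* `TorusChart.axSum F k h x = Σ_{m < x_k} h (foot + m • e_k)` — the partial sum of a function along the `k`-line
  through `x`, from the slice up to (excluding) `x`; `axSum_add_gen_self_of_lt` (one more term across a
  non-wrapping step), `axSum_of_cval_eq_zero`, `axSum_seam` (at the last site the partial sum plus the last
  term is the full circle sum), `axSum_add_gen_of_ne` (transverse steps act on the summand);
* `TorusChart.circSum F k h x = Σ_{m < N_k} h (foot + m • e_k)` — the full circle sum; invariant under `e_k`
  (`circSum_add_gen_self`), transverse equivariant (`circSum_add_gen_of_ne`), kills `k`-differences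
  (`circSum_sub_add_gen_self`: `Σ (h (y + e_k) - h y) = 0`), and on the axes `circSum k h (m • e_j)` is the
  plain double-index sum (`circSum_nsmul_gen_of_ne`).

Everything is proved; no named fact is introduced. [folklore]
-/

namespace Literature.MathematicalPhysics.QuantumFieldTheory

open scoped BigOperators

namespace TorusChart

variable {Λ : Type*} [AddCommGroup Λ] {d : ℕ} (F : TorusChart Λ d)

/-! ## The foot of a site on a coordinate slice -/

/-- The **foot** of `x` on the slice `{x_k = 0}`: go forward `N_k - x_k` steps in direction `k` (so only additions
of unit translations are involved). [folklore] -/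
def dropCoord (k : Fin d) (x : Λ) : Λ := x + (F.period k - F.cval k x) • F.gen k

/-- The `k`-th coordinate of the foot vanishes. [folklore] -/
@[simp] theorem cval_dropCoord_self (k : Fin d) (x : Λ) : F.cval k (F.dropCoord k x) = 0 := by
  rw [dropCoord, F.cval_add_nsmul_gen_self, Nat.add_sub_cancel' (F.cval_lt k x).le, Nat.mod_self]

/-- The other coordinates of the foot are those of `x`. [folklore] -/
theorem cval_dropCoord_of_ne {i k : Fin d} (hik : i ≠ k) (x : Λ) : F.cval i (F.dropCoord k x) = F.cval i x := by
  rw [dropCoord, F.cval_add_nsmul_gen_of_ne hik]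

/-- Climbing back from the foot: `foot + x_k • e_k = x`. [folklore] -/
theorem dropCoord_add_cval_nsmul (k : Fin d) (x : Λ) : F.dropCoord k x + F.cval k x • F.gen k = x := by
  rw [dropCoord, add_assoc, ← add_nsmul, Nat.sub_add_cancel (F.cval_lt k x).le, F.add_period_nsmul_gen]

/-- A site on the slice is its own foot. [folklore] -/
theorem dropCoord_of_cval_eq_zero {k : Fin d} {x : Λ} (h : F.cval k x = 0) : F.dropCoord k x = x := by
  rw [dropCoord, h, Nat.sub_zero, F.add_period_nsmul_gen]

/-- The foot does not move under a step in direction `k`. [folklore] -/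
theorem dropCoord_add_gen_self (k : Fin d) (x : Λ) : F.dropCoord k (x + F.gen k) = F.dropCoord k x := by
  refine F.ext_cval fun i => ?_
  by_cases hik : i = k
  · subst hik; rw [cval_dropCoord_self, cval_dropCoord_self]
  · rw [F.cval_dropCoord_of_ne hik, F.cval_dropCoord_of_ne hik, F.cval_add_gen_of_ne _ hik]

/-- The foot does not move under several steps in direction `k`. [folklore] -/
theorem dropCoord_add_nsmul_gen_self (k : Fin d) (x : Λ) :
    ∀ n : ℕ, F.dropCoord k (x + n • F.gen k) = F.dropCoord k x
  | 0 => by rw [zero_nsmul, add_zero]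
  | n + 1 => by rw [succ_nsmul, ← add_assoc, dropCoord_add_gen_self, dropCoord_add_nsmul_gen_self k x n]

/-- The foot moves along with a transverse step. [folklore] -/
theorem dropCoord_add_gen_of_ne {i k : Fin d} (hik : i ≠ k) (x : Λ) :
    F.dropCoord k (x + F.gen i) = F.dropCoord k x + F.gen i := by
  refine F.ext_cval fun j => ?_
  by_cases hjk : j = k
  · subst hjk
    rw [cval_dropCoord_self, F.cval_add_gen_of_ne _ (Ne.symm hik), cval_dropCoord_self]
  · rw [F.cval_dropCoord_of_ne hjk]
    by_cases hji : j = i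
    · subst hji
      rw [F.cval_add_gen_self, F.cval_add_gen_self, F.cval_dropCoord_of_ne hjk]
    · rw [F.cval_add_gen_of_ne _ hji, F.cval_add_gen_of_ne _ hji, F.cval_dropCoord_of_ne hjk]

/-- **The wrapping step lands on the foot**: if `x_k = N_k - 1` then `x + e_k` is the foot of `x`. [folklore] -/
theorem add_gen_eq_dropCoord {k : Fin d} {x : Λ} (hx : F.cval k x + 1 = F.period k) :
    x + F.gen k = F.dropCoord k x := by
  refine F.ext_cval fun i => ?_
  by_cases hik : i = k
  · subst hik; rw [F.cval_add_gen_self_of_eq _ _ hx, cval_dropCoord_self]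
  · rw [F.cval_add_gen_of_ne _ hik, F.cval_dropCoord_of_ne hik]

/-- The foot of an axis site `m • e_j` (`j ≠ k`) is itself. [folklore] -/
theorem dropCoord_nsmul_gen_of_ne {j k : Fin d} (hjk : j ≠ k) (m : ℕ) : F.dropCoord k (m • F.gen j) = m • F.gen j :=
  F.dropCoord_of_cval_eq_zero (F.cval_nsmul_gen_of_ne (Ne.symm hjk) m)

/-- The foot of the origin is the origin. [folklore] -/
@[simp] theorem dropCoord_zero (k : Fin d) : F.dropCoord k (0 : Λ) = 0 :=
  F.dropCoord_of_cval_eq_zero (F.cval_zero k)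

variable {A : Type*} [AddCommGroup A]

/-! ## Partial sums along a line from the slice -/

/-- **Axial partial sum**: `axSum k h x = Σ_{m < x_k} h (foot + m • e_k)`, the sum of `h` over the sites of the
`k`-line through `x` strictly below `x`. [folklore] -/
def axSum (k : Fin d) (h : Λ → A) (x : Λ) : A :=
  ∑ m ∈ Finset.range (F.cval k x), h (F.dropCoord k x + m • F.gen k)

/-- **Circle sum**: `circSum k h x = Σ_{m < N_k} h (foot + m • e_k)`, the sum of `h` over the whole `k`-line
through `x`. [folklore] -/
def circSum (k : Fin d) (h : Λ → A) (x : Λ) : A :=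
  ∑ m ∈ Finset.range (F.period k), h (F.dropCoord k x + m • F.gen k)

/-- Unfolding `axSum`. [folklore] -/
theorem axSum_def (k : Fin d) (h : Λ → A) (x : Λ) :
    F.axSum k h x = ∑ m ∈ Finset.range (F.cval k x), h (F.dropCoord k x + m • F.gen k) := rfl

/-- Unfolding `circSum`. [folklore] -/
theorem circSum_def (k : Fin d) (h : Λ → A) (x : Λ) :
    F.circSum k h x = ∑ m ∈ Finset.range (F.period k), h (F.dropCoord k x + m • F.gen k) := rfl

/-- On the slice the partial sum is empty. [folklore] -/
theorem axSum_of_cval_eq_zero {k : Fin d} (h : Λ → A) {x : Λ} (hx : F.cval k x = 0) : F.axSum k h x = 0 := by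
  rw [axSum, hx, Finset.range_zero, Finset.sum_empty]

/-- **One more term across a non-wrapping step**: `axSum k h (x + e_k) = axSum k h x + h x`. [folklore] -/
theorem axSum_add_gen_self_of_lt (k : Fin d) (h : Λ → A) {x : Λ} (hx : F.cval k x + 1 < F.period k) :
    F.axSum k h (x + F.gen k) = F.axSum k h x + h x := by
  rw [axSum, axSum, F.cval_add_gen_self_of_lt _ _ hx, Finset.sum_range_succ, dropCoord_add_gen_self,
    dropCoord_add_cval_nsmul]

/-- **At the last site of the line** (`x_k = N_k - 1`) the partial sum plus the last term is the circle sum.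
[folklore] -/
theorem axSum_seam (k : Fin d) (h : Λ → A) {x : Λ} (hx : F.cval k x + 1 = F.period k) :
    F.axSum k h x + h x = F.circSum k h x := by
  rw [axSum, circSum, ← hx, Finset.sum_range_succ, dropCoord_add_cval_nsmul]

/-- A transverse step acts on the summand: `axSum k h (x + e_i) = axSum k (h (· + e_i)) x` for `i ≠ k`.
[folklore] -/
theorem axSum_add_gen_of_ne {i k : Fin d} (hik : i ≠ k) (h : Λ → A) (x : Λ) :
    F.axSum k h (x + F.gen i) = F.axSum k (fun y => h (y + F.gen i)) x := by
  rw [axSum, axSum, F.cval_add_gen_of_ne _ (Ne.symm hik), F.dropCoord_add_gen_of_ne hik]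
  refine Finset.sum_congr rfl fun _ _ => ?_
  rw [add_right_comm]

/-- `axSum` is additive in the function. [folklore] -/
theorem axSum_add (k : Fin d) (h h' : Λ → A) (x : Λ) :
    F.axSum k (fun y => h y + h' y) x = F.axSum k h x + F.axSum k h' x := by
  rw [axSum, axSum, axSum, Finset.sum_add_distrib]

/-- `axSum` is subtractive in the function. [folklore] -/
theorem axSum_sub (k : Fin d) (h h' : Λ → A) (x : Λ) :
    F.axSum k (fun y => h y - h' y) x = F.axSum k h x - F.axSum k h' x := by
  rw [axSum, axSum, axSum, Finset.sum_sub_distrib]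

/-- `axSum` of the zero function. [folklore] -/
@[simp] theorem axSum_zero_fun (k : Fin d) (x : Λ) : F.axSum k (fun _ => (0 : A)) x = 0 := by
  rw [axSum, Finset.sum_const_zero]

/-- `axSum` of a pointwise-zero function. [folklore] -/
theorem axSum_eq_zero_of_forall (k : Fin d) {h : Λ → A} (hh : ∀ y, h y = 0) (x : Λ) : F.axSum k h x = 0 :=
  Finset.sum_eq_zero fun _ _ => hh _

/-! ## Full circle sums -/

/-- The circle sum does not see a step along the circle. [folklore] -/
theorem circSum_add_gen_self (k : Fin d) (h : Λ → A) (x : Λ) : F.circSum k h (x + F.gen k) = F.circSum k h x := by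
  rw [circSum, circSum, dropCoord_add_gen_self]

/-- A transverse step acts on the summand of a circle sum. [folklore] -/
theorem circSum_add_gen_of_ne {i k : Fin d} (hik : i ≠ k) (h : Λ → A) (x : Λ) :
    F.circSum k h (x + F.gen i) = F.circSum k (fun y => h (y + F.gen i)) x := by
  rw [circSum, circSum, F.dropCoord_add_gen_of_ne hik]
  refine Finset.sum_congr rfl fun _ _ => ?_
  rw [add_right_comm]

/-- `circSum` is additive in the function. [folklore] -/
theorem circSum_add (k : Fin d) (h h' : Λ → A) (x : Λ) :
    F.circSum k (fun y => h y + h' y) x = F.circSum k h x + F.circSum k h' x := by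
  rw [circSum, circSum, circSum, Finset.sum_add_distrib]

/-- `circSum` is subtractive in the function. [folklore] -/
theorem circSum_sub (k : Fin d) (h h' : Λ → A) (x : Λ) :
    F.circSum k (fun y => h y - h' y) x = F.circSum k h x - F.circSum k h' x := by
  rw [circSum, circSum, circSum, Finset.sum_sub_distrib]

/-- `circSum` of negation. [folklore] -/
theorem circSum_neg (k : Fin d) (h : Λ → A) (x : Λ) :
    F.circSum k (fun y => -h y) x = -F.circSum k h x := by
  rw [circSum, circSum, Finset.sum_neg_distrib]

/-- `circSum` of a pointwise-zero function. [folklore] -/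
theorem circSum_eq_zero_of_forall (k : Fin d) {h : Λ → A} (hh : ∀ y, h y = 0) (x : Λ) : F.circSum k h x = 0 :=
  Finset.sum_eq_zero fun _ _ => hh _

/-- **Circle sums kill differences along the circle**: `Σ_{m<N_k} (h (y_m + e_k) - h y_m) = 0` (telescoping
around a closed loop, `N_k • e_k = 0`). [folklore] -/
theorem circSum_sub_add_gen_self (k : Fin d) (h : Λ → A) (x : Λ) :
    F.circSum k (fun y => h (y + F.gen k) - h y) x = 0 := by
  rw [circSum]
  have htel : ∀ n : ℕ, ∑ m ∈ Finset.range n,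
      (h (F.dropCoord k x + m • F.gen k + F.gen k) - h (F.dropCoord k x + m • F.gen k)) =
      h (F.dropCoord k x + n • F.gen k) - h (F.dropCoord k x) := by
    intro n
    induction n with
    | zero => simp
    | succ n ih => rw [Finset.sum_range_succ, ih, succ_nsmul, ← add_assoc]; abel
  rw [htel, F.add_period_nsmul_gen, sub_self]

/-- **Circle sums through axis sites are plain double-index sums**: for `j ≠ k`,
`circSum k h (m • e_j) = Σ_{n < N_k} h (m • e_j + n • e_k)`. [folklore] -/
theorem circSum_nsmul_gen_of_ne {j k : Fin d} (hjk : j ≠ k) (h : Λ → A) (m : ℕ) :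
    F.circSum k h (m • F.gen j) = ∑ n ∈ Finset.range (F.period k), h (m • F.gen j + n • F.gen k) := by
  rw [circSum, F.dropCoord_nsmul_gen_of_ne hjk]

/-- The circle sum through the origin. [folklore] -/
theorem circSum_origin (k : Fin d) (h : Λ → A) :
    F.circSum k h 0 = ∑ n ∈ Finset.range (F.period k), h (n • F.gen k) := by
  rw [circSum, dropCoord_zero]
  simp only [zero_add]

end TorusChart

end Literature.MathematicalPhysics.QuantumFieldTheory
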